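import Mathlib
import HarnessLib
import Literature.Geometry.DiscreteGeometry.BondGraph
import Summits.AtomisticToContinuum.Crystallization.Theorems.PricedLinkCensusSoftLayerPropagationStubDevelopReach

/-!
# Reach of the graph `5`-ball and one-bond scale arithmetic at `η ≤ 1/100`
# (crux `SoftLayerPropagation`, line `Sketch`, stub `develop_rest`, registered sub-goal `developRest_reach_five`)

Route `PricedLinkCensus`, crux `SoftLayerPropagation` (stmt-AtomisticToContinuum-14233), line
`Sketch`.  Helper file for the registered stub `develop_rest` (remainder of the exact shadow
development): the elementary arithmetic consumed by the reduction of `develop_rest` to the metric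
ordered-caps lemma (sibling file `…DevelopRestReduction`), namely

* `developRest_posPart_sub_le` — subadditivity of the positive part,
  `(a − c)⁺ − (b − c)⁺ ≤ (a − b)⁺` (the penalty of the penalised radial potential
  `dist (y i) · + (8/3)·(nn − (53/50) nn_i)⁺` changes by at most `(8/3)·(nn_v − nn_w)⁺` between two
  sites);
* `developRest_scale_adj`, `developRest_dist_adj` — along a bond of `bondGraph η y`, `η ≤ 1/100`,
  the scale grows by at most the factor `101/100` and the bond is no longer than `101/100` of the
  scale of either end (`nearestDist_le_mul_of_adj`, `dist_le_of_adj`);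
* **`developRest_reach_five`** (registered) — a bond walk of length `≤ 5` from `i` ends within
  `(129/25) nn_i` of `y i` (`Σ_{t=1}^{5} 1.01^t = 5.15201506 ≤ 5.16`) at a site of scale
  `≤ (53/50) nn_i` (`1.01⁵ = 1.0510… ≤ 1.06`), from `Theorems.develop_reach`.

All `[folklore]`; no new definitions.
-/

noncomputable section

namespace Summit.AtomisticToContinuum.Crystallization.Theorems

open Literature.Geometry.DiscreteGeometry

/-- The positive part is subadditive: `(a − c)⁺ − (b − c)⁺ ≤ (a − b)⁺`. [folklore] -/
theorem developRest_posPart_sub_le (a b c : ℝ) : max 0 (a - c) - max 0 (b - c) ≤ max 0 (a - b) := by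
  have h1 : a - c ≤ max 0 (a - b) + max 0 (b - c) := by
    have := le_max_right 0 (a - b)
    have := le_max_right 0 (b - c)
    linarith
  have h2 : (0 : ℝ) ≤ max 0 (a - b) + max 0 (b - c) := add_nonneg (le_max_left _ _) (le_max_left _ _)
  have := max_le h2 h1
  linarith

/-- Along a bond the scale grows by at most the factor `101/100` (`0 ≤ η ≤ 1/100`). [folklore] -/
theorem developRest_scale_adj {η : ℝ} (hη : 0 ≤ η) (hη' : η ≤ 1 / 100) {N : ℕ}
    {y : Fin N → EuclideanSpace ℝ (Fin 3)} {j k : Fin N} (h : (bondGraph η y).Adj j k) :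
    nearestDist y j ≤ 101 / 100 * nearestDist y k := by
  have h1 := nearestDist_le_mul_of_adj (by linarith : (0 : ℝ) ≤ 1 + η) h
  have h0 := nearestDist_nonneg y k
  nlinarith

/-- A bond is no longer than `101/100` of the scale of its first end (`0 ≤ η ≤ 1/100`).
[folklore] -/
theorem developRest_dist_adj {η : ℝ} (hη : 0 ≤ η) (hη' : η ≤ 1 / 100) {N : ℕ}
    {y : Fin N → EuclideanSpace ℝ (Fin 3)} {j k : Fin N} (h : (bondGraph η y).Adj j k) :
    dist (y j) (y k) ≤ 101 / 100 * nearestDist y j := by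
  have h1 := dist_le_of_adj (by linarith : (0 : ℝ) ≤ 1 + η) h
  have h0 := nearestDist_nonneg y j
  nlinarith

/-- **Registered sub-goal `developRest_reach_five`** of the crux item (REACH OF THE GRAPH `5`-BALL
at `η ≤ 1/100`).  A bond walk of length `≤ 5` from `i` ends within `(129/25) nn_i` of `y i`, at a
site of scale `≤ (53/50) nn_i`. [folklore] -/
theorem developRest_reach_five : ∀ (η : ℝ), 0 ≤ η → η ≤ 1 / 100 → ∀ (N : ℕ) (y : Fin N → EuclideanSpace ℝ (Fin 3)) (i j : Fin N) (w : (Literature.Geometry.DiscreteGeometry.bondGraph η y).Walk i j), w.length ≤ 5 → dist (y i) (y j) ≤ 129 / 25 * Literature.Geometry.DiscreteGeometry.nearestDist y i ∧ Literature.Geometry.DiscreteGeometry.nearestDist y j ≤ 53 / 50 * Literature.Geometry.DiscreteGeometry.nearestDist y i := by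
  intro η hη hη' N y i j w hw
  obtain ⟨h1, h2, -⟩ := develop_reach η hη N y i j w
  have hνi := nearestDist_nonneg y i
  have hb : (1 : ℝ) ≤ 1 + η := by linarith
  have hb' : 1 + η ≤ 101 / 100 := by linarith
  have hpow : (1 + η) ^ w.length ≤ (101 / 100 : ℝ) ^ 5 :=
    (pow_le_pow_right₀ hb hw).trans (pow_le_pow_left₀ (by linarith) hb' 5)
  have hsum : ∑ t ∈ Finset.range w.length, (1 + η) ^ (t + 1) ≤ 129 / 25 := by
    calc ∑ t ∈ Finset.range w.length, (1 + η) ^ (t + 1)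
        ≤ ∑ t ∈ Finset.range 5, (1 + η) ^ (t + 1) := by
          apply Finset.sum_le_sum_of_subset_of_nonneg (Finset.range_mono hw)
          intro t _ _
          positivity
      _ ≤ ∑ t ∈ Finset.range 5, (101 / 100 : ℝ) ^ (t + 1) := by
          refine Finset.sum_le_sum fun t _ => ?_
          exact pow_le_pow_left₀ (by linarith) hb' _
      _ ≤ 129 / 25 := by
          simp only [Finset.sum_range_succ, Finset.sum_range_zero]
          norm_num
  have h5 : (101 / 100 : ℝ) ^ 5 ≤ 53 / 50 := by norm_num
  exact ⟨h1.trans (by nlinarith), h2.trans (by nlinarith)⟩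

end Summit.AtomisticToContinuum.Crystallization.Theorems

end
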